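import Mathlib.Algebra.Lie.OfAssociative
import Mathlib.Algebra.Lie.Subalgebra
import Mathlib.LinearAlgebra.Alternating.Curry
import Mathlib.LinearAlgebra.Alternating.Uncurry.Fin
import Mathlib.LinearAlgebra.Quotient.Basic
import Mathlib.Algebra.Homology.HomologicalComplex
import Mathlib.Algebra.Category.ModuleCat.Basic
import HarnessLib

/-!
# The Chevalley–Eilenberg complex with coefficients and relative Lie algebra cohomology

Topic `Algebra/Lie`; namespace `Literature.Algebra.Lie.ChevalleyEilenberg`.  Definitions with
bodies and theorems only (no named fact, no `sorry`).

Let `R` be a commutative ring, `L` a Lie algebra over `R` and `M` an `L`-module (Mathlib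
`LieRingModule L M`, `LieModule R L M`, action `⁅x, m⁆`).  The **Chevalley–Eilenberg cochains**
are the alternating `q`-forms `C^q(L; M) = Hom_R(Λ^q L, M)` (`Cochain R L M q`, Mathlib's
`L [⋀^Fin q]→ₗ[R] M`), with the three operators of [cite: ChevalleyEilenberg1948, §23] /
[cite: BorelWallach2000, I §1.1 (2)–(4)]:

* the **insertion** `i_x : C^{q+1} → C^q`, `(i_x f)(v) = f(x, v)` (`ins`; Mathlib
  `AlternatingMap.curryLeft`);
* the **Lie derivative** `θ_x : C^q → C^q`,
  `(θ_x f)(y₁, …, y_q) = ⁅x, f(y₁, …, y_q)⁆ - ∑ᵢ f(y₁, …, ⁅x, yᵢ⁆, …, y_q)` (`lieDer`; (23.3) of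
  loc. cit., `θ_x` of Borel–Wallach (3));
* the **differential** `d : C^q → C^{q+1}`,
  `(d f)(x₀, …, x_q) = ∑ᵢ (-1)ⁱ ⁅xᵢ, f(…, x̂ᵢ, …)⁆ + ∑_{i<j} (-1)^{i+j} f(⁅xᵢ, xⱼ⁆, …, x̂ᵢ, …, x̂ⱼ,
…)`
  (`d`; (23.1), Borel–Wallach (2), [cite: Weibel1994, Cor. 7.7.3]).

**Construction.**  Chevalley and Eilenberg remark that a direct proof of `δδ = 0` "would be
quite cumbersome" and prove it through the identities (23.5) `i_y θ_x = θ_x i_y - i_{⁅x,y⁆}`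
(sign convention `⁅x, ·⁆`), (23.6) `i_x d = θ_x - d i_x` (Cartan's formula, Borel–Wallach (5)),
(23.7) `θ_{⁅x,y⁆} = θ_x θ_y - θ_y θ_x` and (23.8) `d θ_x = θ_x d`, by induction on the degree.
This file takes (23.5) and (23.6) as the DEFINITIONS of `θ` and `d`: a `(q+1)`-cochain is
determined by its insertions (`ext_ins`), and a linear map `y ↦ g y ∈ C^q` vanishing on tuples
containing `y` uncurries to a `(q+1)`-cochain (`uncurry`, `ins_uncurry`), so `θ` and `d` are
built by recursion on `q` (`lieDerStage`, `dStage`), the vanishing conditions being exactly the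
previous stage of (23.5), (23.6) together with `i_x i_x = 0`, `i_x i_y = -i_y i_x`; then (23.7)
`lieDer_lie`, (23.8) `lieDer_d` and **`d ∘ d = 0`** (`d_d`, (23.2)) follow by the printed
inductions, and `lieDer_unique`, `d_unique` show that (23.5)/(23.6) with the degree-`0` values
`θ_x f = ⁅x, f⁆`, `(d f)(x) = ⁅x, f⁆` characterise the operators; the closed formulas are
recovered in low degree (`d_zero_apply`, `d_one_apply` — the formula of Mathlib's
`LieModule.Cohomology.d₁₂` —, `lieDer_one_apply`).  Everything is linear over an arbitrary
commutative ring `R` (no characteristic or finiteness hypothesis; Chevalley–Eilenberg assume a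
field of characteristic `0` and `dim V < ∞`, Borel–Wallach a field).

**Relative cohomology** [cite: ChevalleyEilenberg1948, §28 (28.1)–(28.2)]
[cite: BorelWallach2000, I §1.2 (1)–(3)].  For a Lie subalgebra `K ≤ L` the relative cochains
`C^q(L, K; M) = Hom_K(Λ^q(L/K), M)` are the cochains annihilated by `i_x` and `θ_x` for all
`x ∈ K` ("orthogonal to `K`"); by (23.6) and (23.8) they form a subcomplex (`Subcomplex.rel`).
For any `d`-stable family of submodules (`Subcomplex`; `Subcomplex.top` = all cochains) the file
defines cocycles `Z^q = S_q ∩ ker d`, coboundaries `B^q = d(S_{q-1})`, `B⁰ = 0`, the cohomology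
`H^q = Z^q / B^q` (`Subcomplex.Cohomology`, an `R`-module; `cohomology R L M q = H^q(L; M)`,
`relCohomology R L M K q = H^q(L, K; M)`), the class map `toCohomology`, the packaging as a
Mathlib `CochainComplex (ModuleCat R) ℕ` (`Subcomplex.toComplex`), and
`H⁰(L, K; M) = M^L ∩ S₀` (`mem_cocycles_zero_iff`, (23.9) / Borel–Wallach 1.2 (3)).  Naturality in
the coefficients (`map`, `lieDer_map`, `d_map`) is proved.

## What is NOT here (TODO)

* the closed alternating-sum formula for `d f` and `θ_x f` in every degree (only `q ≤ 1`);
* the `(𝔤, K)`-complex `C^q(𝔤, K; V) = C^q(𝔤, 𝔨; V)^{K/K⁰}` of a compact/disconnected group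
  [cite: BorelWallach2000, I §5.1 (1)–(4)], products, Künneth, Poincaré duality, long exact
  sequences, the comparison `H^q(L; M) = Ext_{U(L)}(R, M)`;
* Mathlib has Lie algebra cochains only in degrees `≤ 2` (`Mathlib.Algebra.Lie.Cochain`:
  `oneCochain`, `twoCochain`, `d₁₂`, `d₂₃`; its TODO lists "cohomology" and "comparison to the
  Chevalley-Eilenberg complex"), alternating maps with `curryLeft`, `alternatizeUncurryFin`, and
  no relative Lie algebra cohomology (searched: `ChevalleyEilenberg`, `LieAlgebra.cohomology`,
  `relativeLie`).

## Design notes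

* `Cochain R L M q` is an `abbrev` for `L [⋀^Fin q]→ₗ[R] M`, so Mathlib's `AlternatingMap` API
  applies verbatim; `θ` and `d` are bundled `R`-linear (`L →ₗ[R] C^q →ₗ[R] C^q`,
  `C^q →ₗ[R] C^{q+1}`), `θ` is a Lie action by the THEOREM `lieDer_lie` (no instance on the
  Mathlib type is registered).
* Cocycles and coboundaries are submodules of the AMBIENT `Cochain R L M q` (not of the subtype
  of the subcomplex): quotients of a second-level `Submodule` subtype of an `AlternatingMap` space
  do not elaborate (`HasQuotient` instance search fails on the nested coercion).
* Universes: `L`, `M` in arbitrary universes; `toComplex` lands in `ModuleCat.{max v w} R`.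

## References

* C. Chevalley, S. Eilenberg, *Cohomology theory of Lie groups and Lie algebras*, Trans. Amer.
  Math. Soc. 63 (1948) 85–124: §23 (23.1)–(23.9) (pp. 115–117), §28 (28.1)–(28.2) (p. 123)
  (open, read 2026-08-16) [ChevalleyEilenberg1948].
* A. Borel, N. Wallach, *Continuous cohomology, discrete subgroups, and representations of
  reductive groups*, 2nd ed., Math. Surveys Monogr. 67 (2000): Ch. I §1.1 (1)–(7), §1.2 (1)–(4),
  §5.1 (1)–(4) (held, read 2026-08-16) [BorelWallach2000].
* C. Weibel, *An introduction to homological algebra* (1994), §7.7, Cor. 7.7.3 (held)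
  [Weibel1994].
-/

open Fin Function

namespace Literature.Algebra.Lie

namespace ChevalleyEilenberg

variable {R : Type*} [CommRing R] {L : Type*} [LieRing L] [LieAlgebra R L]
  {M : Type*} [AddCommGroup M] [Module R M]

/-- Chevalley–Eilenberg `q`-cochains of `L` with values in `M`: alternating `q`-forms.
[cite: ChevalleyEilenberg1948, §23] -/
abbrev Cochain (R L M : Type*) [CommRing R] [LieRing L] [LieAlgebra R L] [AddCommGroup M]
    [Module R M] (q : ℕ) : Type _ :=
  L [⋀^Fin q]→ₗ[R] M

/-- Insertion (contraction) `i_x : C^{q+1} → C^q`, `(i_x f)(v) = f(x, v)`.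
[cite: ChevalleyEilenberg1948, §23 (23.4)] -/
def ins (q : ℕ) (x : L) : Cochain R L M (q + 1) →ₗ[R] Cochain R L M q :=
  (AlternatingMap.curryLeftLinearMap (R := R) (M := L) (N := M) (n := q)).flip x

/-- `(i_x f)(v) = f(x, v)`. [cite: ChevalleyEilenberg1948, §23 (23.4)] -/
@[simp] theorem ins_apply (q : ℕ) (x : L) (f : Cochain R L M (q + 1)) (v : Fin q → L) :
    ins q x f v = f (Matrix.vecCons x v) := rfl

/-- `i_x` is Mathlib's `AlternatingMap.curryLeft`. [folklore] -/
theorem ins_eq_curryLeft (q : ℕ) (x : L) (f : Cochain R L M (q + 1)) :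
    ins q x f = f.curryLeft x := rfl

/-- `i_x i_x = 0` (alternation). [folklore] -/
@[simp] theorem ins_self (q : ℕ) (x : L) (f : Cochain R L M (q + 2)) :
    ins q x (ins (q + 1) x f) = 0 :=
  AlternatingMap.curryLeft_same f x

/-- `i_{x+y} = i_x + i_y`. [folklore] -/
theorem ins_add (q : ℕ) (x y : L) (f : Cochain R L M (q + 1)) :
    ins q (x + y) f = ins q x f + ins q y f := by
  simp [ins_eq_curryLeft]

/-- `i_{c x} = c i_x`. [folklore] -/
theorem ins_smul (q : ℕ) (c : R) (x : L) (f : Cochain R L M (q + 1)) :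
    ins q (c • x) f = c • ins q x f := by
  simp [ins_eq_curryLeft]

/-- `i_0 = 0`. [folklore] -/
@[simp] theorem ins_zero_left (q : ℕ) (f : Cochain R L M (q + 1)) : ins q (0 : L) f = 0 := by
  simp [ins_eq_curryLeft]

/-- `i_{x-y} = i_x - i_y`. [folklore] -/
theorem ins_sub (q : ℕ) (x y : L) (f : Cochain R L M (q + 1)) :
    ins q (x - y) f = ins q x f - ins q y f := by
  simp [ins_eq_curryLeft]

/-- Insertions anticommute. [folklore] -/
theorem ins_ins (q : ℕ) (x y : L) (f : Cochain R L M (q + 2)) :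
    ins q x (ins (q + 1) y f) = -ins q y (ins (q + 1) x f) := by
  have h := ins_self q (x + y) f
  simp only [ins_add, map_add, ins_self, zero_add, add_zero] at h
  rw [add_comm] at h
  exact eq_neg_of_add_eq_zero_left h

/-- A `(q+1)`-cochain is determined by its insertions. [folklore] -/
theorem ext_ins {q : ℕ} {f g : Cochain R L M (q + 1)} (h : ∀ x, ins q x f = ins q x g) :
    f = g := by
  refine AlternatingMap.ext fun v => ?_
  have e := congrArg (fun φ : Cochain R L M q => φ (Fin.tail v)) (h (v 0))
  simpa [ins_apply, Matrix.vecCons, Fin.cons_self_tail] using e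

/-- An alternating `(q+1)`-form whose insertion of `x` vanishes, vanishes on every tuple
containing `x`. [folklore] -/
theorem apply_eq_zero_of_ins_eq_zero {q : ℕ} {f : Cochain R L M (q + 1)} {x : L}
    (h : ins q x f = 0) (v : Fin (q + 1) → L) (i : Fin (q + 1)) (hi : v i = x) : f v = 0 := by
  have hv : v = i.insertNth x (i.removeNth v) := by rw [← hi, Fin.insertNth_self_removeNth]
  rw [hv, AlternatingMap.map_insertNth]
  have e : f (Matrix.vecCons x (i.removeNth v)) = ins q x f (i.removeNth v) := rfl
  rw [e, h, AlternatingMap.zero_apply, smul_zero]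

/-- Uncurrying: from `g : L →ₗ C^q` vanishing on tuples containing the first argument, the
`(q+1)`-cochain `v ↦ g (v 0) (tail v)`. [folklore] -/
def uncurry {q : ℕ} (g : L →ₗ[R] Cochain R L M q)
    (hg : ∀ (x : L) (v : Fin q → L) (i : Fin q), v i = x → g x v = 0) :
    Cochain R L M (q + 1) where
  toMultilinearMap := LinearMap.uncurryLeft (AlternatingMap.toMultilinearMapLM (S := R) ∘ₗ g)
  map_eq_zero_of_eq' := by
    intro v i j hv hij
    change (LinearMap.uncurryLeft (AlternatingMap.toMultilinearMapLM (S := R) ∘ₗ g)) v = 0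
    rw [LinearMap.uncurryLeft_apply]
    change g (v 0) (Fin.tail v) = 0
    induction i using Fin.cases with
    | zero =>
      induction j using Fin.cases with
      | zero => exact absurd rfl hij
      | succ j => exact hg (v 0) (Fin.tail v) j hv.symm
    | succ i =>
      induction j using Fin.cases with
      | zero => exact hg (v 0) (Fin.tail v) i hv
      | succ j =>
        exact (g (v 0)).map_eq_zero_of_eq (Fin.tail v) (i := i) (j := j) hv
          (fun e => hij (congrArg Fin.succ e))

/-- `(uncurry g)(v) = g (v 0) (tail v)`. [folklore] -/
@[simp] theorem uncurry_apply {q : ℕ} (g : L →ₗ[R] Cochain R L M q) (hg) (v : Fin (q + 1) → L) :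
    uncurry g hg v = g (v 0) (Fin.tail v) := by
  simp [uncurry]

/-- `i_x (uncurry g) = g x`: uncurrying inverts insertion. [folklore] -/
@[simp] theorem ins_uncurry {q : ℕ} (g : L →ₗ[R] Cochain R L M q) (hg) (x : L) :
    ins q x (uncurry g hg) = g x := by
  ext v
  simp [uncurry, Matrix.vecCons]

/-- The vanishing hypothesis of `uncurry` in degree `q + 1` follows from `i_x (g x) = 0`.
[folklore] -/
theorem uncurry_cond {q : ℕ} (g : L →ₗ[R] Cochain R L M (q + 1))
    (hg : ∀ x, ins q x (g x) = 0) :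
    ∀ (x : L) (v : Fin (q + 1) → L) (i : Fin (q + 1)), v i = x → g x v = 0 :=
  fun x v i hi => apply_eq_zero_of_ins_eq_zero (hg x) v i hi

/-- In degree `0` the hypothesis of `uncurry` is vacuous. [folklore] -/
theorem uncurry_cond_zero (g : L →ₗ[R] Cochain R L M 0) :
    ∀ (x : L) (v : Fin 0 → L) (i : Fin 0), v i = x → g x v = 0 :=
  fun _ _ i => i.elim0


/-! ### Uncurried operators `f ↦ (y ↦ θ_x (i_y f) - i_{⁅x,y⁆} f)` -/

section Op

variable (R L M) in
/-- One stage of the recursive construction of the Lie derivative: the operators in two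
consecutive degrees `q`, `q + 1`, linked by `i_y θ_x = θ_x i_y - i_{⁅x,y⁆}`.
[cite: ChevalleyEilenberg1948, §23 (23.5)] -/
structure LieDerStage (q : ℕ) where
  /-- the Lie derivative in degree `q` -/
  lo : L →ₗ[R] Cochain R L M q →ₗ[R] Cochain R L M q
  /-- the Lie derivative in degree `q + 1` -/
  hi : L →ₗ[R] Cochain R L M (q + 1) →ₗ[R] Cochain R L M (q + 1)
  /-- the link `i_y (θ_x f) = θ_x (i_y f) - i_{⁅x, y⁆} f` -/
  link : ∀ (x y : L) (f : Cochain R L M (q + 1)),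
    ins q y (hi x f) = lo x (ins q y f) - ins q ⁅x, y⁆ f

/-- The linear map `y ↦ θ_x (i_y f) - i_{⁅x,y⁆} f` (to be uncurried into `θ_x f`).
[cite: ChevalleyEilenberg1948, §23 (23.5)] -/
def lieDerFun (q : ℕ) (θ : L →ₗ[R] Cochain R L M q →ₗ[R] Cochain R L M q) (x : L)
    (f : Cochain R L M (q + 1)) : L →ₗ[R] Cochain R L M q :=
  (θ x).comp ((AlternatingMap.curryLeftLinearMap (R := R) (n := q)) f) -
    ((AlternatingMap.curryLeftLinearMap (R := R) (n := q)) f).comp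
      (LieModule.toEnd R L L x : L →ₗ[R] L)

/-- Unfolding of `lieDerFun`. [cite: ChevalleyEilenberg1948, §23 (23.5)] -/
@[simp] theorem lieDerFun_apply (q : ℕ) (θ : L →ₗ[R] Cochain R L M q →ₗ[R] Cochain R L M q)
    (x y : L) (f : Cochain R L M (q + 1)) :
    lieDerFun q θ x f y = θ x (ins q y f) - ins q ⁅x, y⁆ f := rfl

/-- `lieDerFun` is additive in `x`. [folklore] -/
theorem lieDerFun_add_left (q : ℕ) (θ : L →ₗ[R] Cochain R L M q →ₗ[R] Cochain R L M q)
    (x₁ x₂ : L) (f : Cochain R L M (q + 1)) :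
    lieDerFun q θ (x₁ + x₂) f = lieDerFun q θ x₁ f + lieDerFun q θ x₂ f := by
  ext y v
  simp only [lieDerFun_apply, map_add, add_lie, ins_add, LinearMap.add_apply,
    AlternatingMap.sub_apply, AlternatingMap.add_apply]
  abel

/-- `lieDerFun` is homogeneous in `x`. [folklore] -/
theorem lieDerFun_smul_left (q : ℕ) (θ : L →ₗ[R] Cochain R L M q →ₗ[R] Cochain R L M q)
    (c : R) (x : L) (f : Cochain R L M (q + 1)) :
    lieDerFun q θ (c • x) f = c • lieDerFun q θ x f := by
  ext y v
  simp only [lieDerFun_apply, map_smul, smul_lie, ins_smul, LinearMap.smul_apply,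
    AlternatingMap.sub_apply, AlternatingMap.smul_apply, smul_sub]

/-- `lieDerFun` is additive in `f`. [folklore] -/
theorem lieDerFun_add_right (q : ℕ) (θ : L →ₗ[R] Cochain R L M q →ₗ[R] Cochain R L M q)
    (x : L) (f₁ f₂ : Cochain R L M (q + 1)) :
    lieDerFun q θ x (f₁ + f₂) = lieDerFun q θ x f₁ + lieDerFun q θ x f₂ := by
  ext y v
  simp only [lieDerFun_apply, map_add, LinearMap.add_apply, AlternatingMap.sub_apply,
    AlternatingMap.add_apply]
  abel

/-- `lieDerFun` is homogeneous in `f`. [folklore] -/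
theorem lieDerFun_smul_right (q : ℕ) (θ : L →ₗ[R] Cochain R L M q →ₗ[R] Cochain R L M q)
    (c : R) (x : L) (f : Cochain R L M (q + 1)) :
    lieDerFun q θ x (c • f) = c • lieDerFun q θ x f := by
  ext y v
  simp only [lieDerFun_apply, map_smul, LinearMap.smul_apply, AlternatingMap.sub_apply,
    AlternatingMap.smul_apply, smul_sub]

/-- Uncurry `lieDerFun` into an operator `L →ₗ C^{q+1} →ₗ C^{q+1}`, given the vanishing
condition. [cite: ChevalleyEilenberg1948, §23 (23.5)] -/
def lieDerOp (q : ℕ) (θ : L →ₗ[R] Cochain R L M q →ₗ[R] Cochain R L M q)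
    (h : ∀ (x : L) (f : Cochain R L M (q + 1)) (y : L) (v : Fin q → L) (i : Fin q),
      v i = y → lieDerFun q θ x f y v = 0) :
    L →ₗ[R] Cochain R L M (q + 1) →ₗ[R] Cochain R L M (q + 1) :=
  LinearMap.mk₂ R (fun x f => uncurry (lieDerFun q θ x f) (h x f))
    (fun x₁ x₂ f => ext_ins fun z => by
      simp only [ins_uncurry, map_add, LinearMap.add_apply, lieDerFun_add_left])
    (fun c x f => ext_ins fun z => by
      simp only [ins_uncurry, map_smul, LinearMap.smul_apply, lieDerFun_smul_left])
    (fun x f₁ f₂ => ext_ins fun z => by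
      simp only [ins_uncurry, map_add, lieDerFun_add_right, LinearMap.add_apply])
    (fun c x f => ext_ins fun z => by
      simp only [ins_uncurry, map_smul, lieDerFun_smul_right, LinearMap.smul_apply])

/-- `i_y (lieDerOp θ x f) = θ_x (i_y f) - i_{⁅x,y⁆} f`. [cite: ChevalleyEilenberg1948, §23 (23.5)]
-/
@[simp] theorem ins_lieDerOp (q : ℕ) (θ : L →ₗ[R] Cochain R L M q →ₗ[R] Cochain R L M q) (h)
    (x y : L) (f : Cochain R L M (q + 1)) :
    ins q y (lieDerOp q θ h x f) = θ x (ins q y f) - ins q ⁅x, y⁆ f := by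
  simp [lieDerOp]

/-- The vanishing condition in degree `q + 2` follows from the link of a stage.
[cite: ChevalleyEilenberg1948, §23 (23.5)] -/
theorem lieDerFun_cond_succ (q : ℕ) (S : LieDerStage R L M q) (x : L)
    (f : Cochain R L M (q + 2)) (y : L) : ins q y (lieDerFun (q + 1) S.hi x f y) = 0 := by
  rw [lieDerFun_apply, map_sub, S.link, ins_self, map_zero, zero_sub, ins_ins, neg_neg, sub_self]

/-- The inductive step of the construction of the Lie derivative.
[cite: ChevalleyEilenberg1948, §23 (23.5)] -/
def LieDerStage.succ {q : ℕ} (S : LieDerStage R L M q) : LieDerStage R L M (q + 1) where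
  lo := S.hi
  hi := lieDerOp (q + 1) S.hi fun x f =>
    uncurry_cond (lieDerFun (q + 1) S.hi x f) (lieDerFun_cond_succ q S x f)
  link x y f := ins_lieDerOp (q + 1) _ _ x y f

end Op

/-! ### The Lie derivative `θ_x` on cochains (Cartan calculus, by recursion on the degree) -/

section LieDer

variable [LieRingModule L M] [LieModule R L M]

variable (R L M) in
/-- The action of `x ∈ L` on the VALUES of a cochain: `f ↦ (v ↦ ⁅x, f v⁆)`; in degree `0`
this is the Lie derivative. [cite: ChevalleyEilenberg1948, §23 (23.3)] -/
def valAct (q : ℕ) : L →ₗ[R] Cochain R L M q →ₗ[R] Cochain R L M q where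
  toFun x := LinearMap.compAlternatingMapₗ R (LieModule.toEnd R L M x)
  map_add' x y := by ext f v; simp
  map_smul' c x := by ext f v; simp

/-- `(valAct x f)(v) = ⁅x, f v⁆`. [cite: ChevalleyEilenberg1948, §23 (23.3)] -/
@[simp] theorem valAct_apply (q : ℕ) (x : L) (f : Cochain R L M q) (v : Fin q → L) :
    valAct R L M q x f v = ⁅x, f v⁆ := rfl

/-- Stage `0`: `θ_x` in degree `0` acts on values; degree `1` by uncurrying.
[cite: ChevalleyEilenberg1948, §23 (23.3), (23.5)] -/
def lieDerStageZero : LieDerStage R L M 0 where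
  lo := valAct R L M 0
  hi := lieDerOp 0 (valAct R L M 0) fun x f => uncurry_cond_zero (lieDerFun 0 _ x f)
  link x y f := ins_lieDerOp 0 _ _ x y f

variable (R L M) in
/-- All stages, by recursion on the degree. [cite: ChevalleyEilenberg1948, §23 (23.5)] -/
def lieDerStage : (q : ℕ) → LieDerStage R L M q
  | 0 => lieDerStageZero
  | q + 1 => (lieDerStage q).succ

variable (R L M) in
/-- **The Lie derivative** `θ_x : C^q(L; M) → C^q(L; M)` (`x ∈ L`), the natural action of `L`
on `Hom(Λ^q L, M)`: `(θ_x f)(y₁, …, y_q) = ⁅x, f(y₁, …, y_q)⁆ - ∑ᵢ f(y₁, …, ⁅x, yᵢ⁆, …, y_q)`,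
constructed by recursion on `q` through `i_y ∘ θ_x = θ_x ∘ i_y - i_{⁅x,y⁆}`.
[cite: ChevalleyEilenberg1948, §23 (23.3)] -/
def lieDer (q : ℕ) : L →ₗ[R] Cochain R L M q →ₗ[R] Cochain R L M q :=
  (lieDerStage R L M q).lo

/-- `θ` in degree `q + 1` is the upper operator of stage `q` (definitional). [folklore] -/
theorem lieDer_succ_eq (q : ℕ) : lieDer R L M (q + 1) = (lieDerStage R L M q).hi := rfl

/-- In degree `0`, `θ_x f = ⁅x, f⁆` (`d_x f = P_x f`). [cite: ChevalleyEilenberg1948, §23 (23.3)] -/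
@[simp] theorem lieDer_zero_apply (x : L) (f : Cochain R L M 0) (v : Fin 0 → L) :
    lieDer R L M 0 x f v = ⁅x, f v⁆ := rfl

/-- **Cartan's relation `i_y θ_x = θ_x i_y - i_{⁅x,y⁆}`** (defining recursion of `θ`).
[cite: ChevalleyEilenberg1948, §23 (23.5)] -/
theorem ins_lieDer (q : ℕ) (x y : L) (f : Cochain R L M (q + 1)) :
    ins q y (lieDer R L M (q + 1) x f) = lieDer R L M q x (ins q y f) - ins q ⁅x, y⁆ f :=
  (lieDerStage R L M q).link x y f


/-- **`θ` is a Lie algebra action**: `θ_{⁅x,y⁆} = θ_x θ_y - θ_y θ_x`.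
[cite: ChevalleyEilenberg1948, §23 (23.7)] -/
theorem lieDer_lie (q : ℕ) (x y : L) (f : Cochain R L M q) :
    lieDer R L M q ⁅x, y⁆ f =
      lieDer R L M q x (lieDer R L M q y f) - lieDer R L M q y (lieDer R L M q x f) := by
  induction q generalizing x y with
  | zero => ext v; simp [lie_lie]
  | succ q ih =>
    refine ext_ins fun z => ?_
    simp only [ins_lieDer, map_sub, ih, lie_lie x y z, ins_sub]
    abel

end LieDer

/-! ### The differential (by recursion on the degree, through Cartan's formula) -/

section Differential

variable [LieRingModule L M] [LieModule R L M]

/-- The linear map `y ↦ θ_y f - D (i_y f)` (to be uncurried into `d f`).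
[cite: ChevalleyEilenberg1948, §23 (23.6)] -/
def dFun (q : ℕ) (D : Cochain R L M q →ₗ[R] Cochain R L M (q + 1)) (f : Cochain R L M (q + 1)) :
    L →ₗ[R] Cochain R L M (q + 1) :=
  (lieDer R L M (q + 1)).flip f - D.comp ((AlternatingMap.curryLeftLinearMap (R := R) (n := q)) f)

/-- Unfolding of `dFun`. [cite: ChevalleyEilenberg1948, §23 (23.6)] -/
@[simp] theorem dFun_apply (q : ℕ) (D : Cochain R L M q →ₗ[R] Cochain R L M (q + 1))
    (f : Cochain R L M (q + 1)) (y : L) :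
    dFun q D f y = lieDer R L M (q + 1) y f - D (ins q y f) := rfl

/-- Uncurry `dFun` into an operator `C^{q+1} →ₗ C^{q+2}`, given the vanishing condition.
[cite: ChevalleyEilenberg1948, §23 (23.6)] -/
def dOp (q : ℕ) (D : Cochain R L M q →ₗ[R] Cochain R L M (q + 1))
    (h : ∀ (f : Cochain R L M (q + 1)) (y : L), ins q y (dFun q D f y) = 0) :
    Cochain R L M (q + 1) →ₗ[R] Cochain R L M (q + 2) where
  toFun f := uncurry (dFun q D f) (uncurry_cond _ (h f))
  map_add' f g := ext_ins fun z => by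
    simp only [ins_uncurry, dFun_apply, map_add]
    abel
  map_smul' c f := ext_ins fun z => by
    simp only [ins_uncurry, dFun_apply, map_smul, RingHom.id_apply, smul_sub]

/-- `i_y (dOp D f) = θ_y f - D (i_y f)`. [cite: ChevalleyEilenberg1948, §23 (23.6)] -/
@[simp] theorem ins_dOp (q : ℕ) (D : Cochain R L M q →ₗ[R] Cochain R L M (q + 1)) (h)
    (y : L) (f : Cochain R L M (q + 1)) :
    ins (q + 1) y (dOp q D h f) = lieDer R L M (q + 1) y f - D (ins q y f) := by
  simp [dOp]

variable (R L M) in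
/-- One stage of the recursive construction of the differential: `d` in two consecutive
degrees, linked by Cartan's formula `i_y d = θ_y - d i_y`.
[cite: ChevalleyEilenberg1948, §23 (23.6)] -/
structure DStage (q : ℕ) where
  /-- the differential `C^q → C^{q+1}` -/
  lo : Cochain R L M q →ₗ[R] Cochain R L M (q + 1)
  /-- the differential `C^{q+1} → C^{q+2}` -/
  hi : Cochain R L M (q + 1) →ₗ[R] Cochain R L M (q + 2)
  /-- Cartan's formula `i_y (d f) = θ_y f - d (i_y f)` in degree `q + 1` -/
  link : ∀ (y : L) (f : Cochain R L M (q + 1)),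
    ins (q + 1) y (hi f) = lieDer R L M (q + 1) y f - lo (ins q y f)

/-- The vanishing condition for the next degree follows from Cartan's formula.
[cite: ChevalleyEilenberg1948, §23 (23.6)] -/
theorem dFun_cond_succ {q : ℕ} (S : DStage R L M q) (f : Cochain R L M (q + 2)) (y : L) :
    ins (q + 1) y (dFun (q + 1) S.hi f y) = 0 := by
  rw [dFun_apply, map_sub, ins_lieDer, S.link, lie_self, ins_zero_left, ins_self, map_zero,
    sub_zero, sub_self]

/-- The inductive step of the construction of the differential.
[cite: ChevalleyEilenberg1948, §23 (23.6)] -/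
def DStage.succ {q : ℕ} (S : DStage R L M q) : DStage R L M (q + 1) where
  lo := S.hi
  hi := dOp (q + 1) S.hi (dFun_cond_succ S)
  link y f := ins_dOp (q + 1) _ _ y f

variable (R L M) in
/-- The differential in degree `0`: `(d f)(x) = ⁅x, f()⁆`.
[cite: ChevalleyEilenberg1948, §23 (23.1)] -/
def dZero : Cochain R L M 0 →ₗ[R] Cochain R L M 1 where
  toFun f := uncurry ((lieDer R L M 0).flip f) (uncurry_cond_zero _)
  map_add' f g := ext_ins fun z => by simp
  map_smul' c f := ext_ins fun z => by simp

/-- `i_y (d f) = θ_y f` in degree `0`, i.e. `(δf)(x) = P(x) f`.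
[cite: ChevalleyEilenberg1948, §23 (23.1)] -/
@[simp] theorem ins_dZero (y : L) (f : Cochain R L M 0) :
    ins 0 y (dZero R L M f) = lieDer R L M 0 y f := by
  simp [dZero]

/-- The vanishing condition for `d` in degree `1`. [cite: ChevalleyEilenberg1948, §23 (23.6)] -/
theorem dFun_cond_zero (f : Cochain R L M 1) (y : L) : ins 0 y (dFun 0 (dZero R L M) f y) = 0 := by
  rw [dFun_apply, map_sub, ins_lieDer, ins_dZero, lie_self, ins_zero_left, sub_zero, sub_self]

variable (R L M) in
/-- Stage `0` of the differential. [cite: ChevalleyEilenberg1948, §23 (23.1), (23.6)] -/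
def dStageZero : DStage R L M 0 where
  lo := dZero R L M
  hi := dOp 0 (dZero R L M) dFun_cond_zero
  link y f := ins_dOp 0 _ _ y f

variable (R L M) in
/-- All stages of the differential, by recursion on the degree.
[cite: ChevalleyEilenberg1948, §23 (23.6)] -/
def dStage : (q : ℕ) → DStage R L M q
  | 0 => dStageZero R L M
  | q + 1 => (dStage q).succ

variable (R L M) in
/-- **The Chevalley–Eilenberg differential** `d : C^q(L; M) → C^{q+1}(L; M)`,
`(d f)(x₀, …, x_q) = ∑ᵢ (-1)ⁱ ⁅xᵢ, f(…, x̂ᵢ, …)⁆ + ∑_{i<j} (-1)^{i+j} f(⁅xᵢ, xⱼ⁆, …, x̂ᵢ, …, x̂ⱼ,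
…)`,
constructed by recursion on `q` through Cartan's formula `i_y ∘ d = θ_y - d ∘ i_y` (and
`i_y (d f) = θ_y f` in degree `0`). [cite: ChevalleyEilenberg1948, §23 (23.1)] -/
def d (q : ℕ) : Cochain R L M q →ₗ[R] Cochain R L M (q + 1) :=
  (dStage R L M q).lo

/-- `d` in degree `q + 1` is the upper operator of stage `q` (definitional). [folklore] -/
theorem d_succ_eq (q : ℕ) : d R L M (q + 1) = (dStage R L M q).hi := rfl

/-- `d` in degree `0` is `dZero` (definitional). [folklore] -/
theorem d_zero_eq : d R L M 0 = dZero R L M := rfl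

/-- Cartan's formula in degree `0`: `i_y (d f) = θ_y f`. [cite: ChevalleyEilenberg1948, §23 (23.1)]
-/
@[simp] theorem ins_d_zero (y : L) (f : Cochain R L M 0) :
    ins 0 y (d R L M 0 f) = lieDer R L M 0 y f :=
  ins_dZero y f

/-- **Cartan's formula** `i_y (d f) = θ_y f - d (i_y f)` (defining recursion of `d`).
[cite: ChevalleyEilenberg1948, §23 (23.6)] -/
theorem ins_d_succ (q : ℕ) (y : L) (f : Cochain R L M (q + 1)) :
    ins (q + 1) y (d R L M (q + 1) f) = lieDer R L M (q + 1) y f - d R L M q (ins q y f) :=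
  (dStage R L M q).link y f

/-- **The differential commutes with the Lie derivative**: `θ_x ∘ d = d ∘ θ_x`.
[cite: ChevalleyEilenberg1948, §23 (23.8)] -/
theorem lieDer_d (q : ℕ) (x : L) (f : Cochain R L M q) :
    lieDer R L M (q + 1) x (d R L M q f) = d R L M q (lieDer R L M q x f) := by
  induction q generalizing x with
  | zero =>
    refine ext_ins fun z => ?_
    rw [ins_lieDer, ins_d_zero, ins_d_zero, ins_d_zero, lieDer_lie]
    abel
  | succ q ih =>
    refine ext_ins fun z => ?_
    simp only [ins_lieDer, ins_d_succ, map_sub, ih, lieDer_lie]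
    abel

/-- **`d ∘ d = 0`.** [cite: ChevalleyEilenberg1948, §23 (23.2)] -/
theorem d_d (q : ℕ) (f : Cochain R L M q) : d R L M (q + 1) (d R L M q f) = 0 := by
  induction q with
  | zero =>
    refine ext_ins fun z => ?_
    rw [ins_d_succ, ins_d_zero, lieDer_d, sub_self, map_zero]
  | succ q ih =>
    refine ext_ins fun z => ?_
    rw [ins_d_succ, ins_d_succ, map_sub, lieDer_d, ih, sub_zero, sub_self, map_zero]

/-- `d ∘ d = 0` as a composition of linear maps. [cite: ChevalleyEilenberg1948, §23 (23.2)] -/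
theorem d_comp_d (q : ℕ) : (d R L M (q + 1)).comp (d R L M q) = 0 :=
  LinearMap.ext (d_d q)

/-! ### Uniqueness: the recursions characterise `θ` and `d` -/

/-- **Uniqueness of the Lie derivative**: operators agreeing with the action on values in
degree `0` and satisfying `i_y Θ_x = Θ_x i_y - i_{⁅x,y⁆}` are the `θ_x`. [folklore] -/
theorem lieDer_unique (Θ : (q : ℕ) → L → Cochain R L M q →ₗ[R] Cochain R L M q)
    (h0 : ∀ (x : L) (f : Cochain R L M 0), Θ 0 x f = lieDer R L M 0 x f)
    (hs : ∀ (q : ℕ) (x y : L) (f : Cochain R L M (q + 1)),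
      ins q y (Θ (q + 1) x f) = Θ q x (ins q y f) - ins q ⁅x, y⁆ f)
    (q : ℕ) (x : L) (f : Cochain R L M q) : Θ q x f = lieDer R L M q x f := by
  induction q generalizing x with
  | zero => exact h0 x f
  | succ q ih => exact ext_ins fun y => by rw [hs, ins_lieDer, ih]

/-- **Uniqueness of the differential**: operators satisfying Cartan's formula (and
`i_y (D f) = θ_y f` in degree `0`) are the `d`. [folklore] -/
theorem d_unique (D : (q : ℕ) → Cochain R L M q →ₗ[R] Cochain R L M (q + 1))
    (h0 : ∀ (y : L) (f : Cochain R L M 0), ins 0 y (D 0 f) = lieDer R L M 0 y f)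
    (hs : ∀ (q : ℕ) (y : L) (f : Cochain R L M (q + 1)),
      ins (q + 1) y (D (q + 1) f) = lieDer R L M (q + 1) y f - D q (ins q y f))
    (q : ℕ) (f : Cochain R L M q) : D q f = d R L M q f := by
  induction q with
  | zero => exact ext_ins fun y => by rw [h0, ins_d_zero]
  | succ q ih => exact ext_ins fun y => by rw [hs, ins_d_succ, ih]

/-! ### Low degrees -/

/-- `(θ_x f)(y) = ⁅x, f(y)⁆ - f(⁅x, y⁆)` in degree `1`. [cite: ChevalleyEilenberg1948, §23 (23.3)]
-/
theorem lieDer_one_apply (x y : L) (f : Cochain R L M 1) :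
    lieDer R L M 1 x f ![y] = ⁅x, f ![y]⁆ - f ![⁅x, y⁆] := by
  have e := congrArg (fun φ : Cochain R L M 0 => φ ![]) (ins_lieDer (R := R) (M := M) 0 x y f)
  simpa using e

/-- `(d f)(x) = ⁅x, f()⁆` in degree `0` (`(δf)(x) = P(x) f`).
[cite: ChevalleyEilenberg1948, §23 (23.1)] -/
theorem d_zero_apply (f : Cochain R L M 0) (v : Fin 1 → L) :
    d R L M 0 f v = ⁅v 0, f (Fin.tail v)⁆ := by
  simp [d_zero_eq, dZero]

/-- `(d f)(x) = ⁅x, f()⁆` in degree `0`, matrix-literal form.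
[cite: ChevalleyEilenberg1948, §23 (23.1)] -/
theorem d_zero_apply_one (f : Cochain R L M 0) (x : L) :
    d R L M 0 f ![x] = ⁅x, f ![]⁆ := by
  rw [d_zero_apply]
  congr 2

/-- `(d f)(x, y) = ⁅x, f(y)⁆ - ⁅y, f(x)⁆ - f(⁅x, y⁆)` (the formula of Mathlib's
`LieModule.Cohomology.d₁₂`). [cite: BorelWallach2000, I §1.1 (2)] -/
theorem d_one_apply (f : Cochain R L M 1) (x y : L) :
    d R L M 1 f ![x, y] = ⁅x, f ![y]⁆ - ⁅y, f ![x]⁆ - f ![⁅x, y⁆] := by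
  have h1 := lieDer_one_apply (R := R) (M := M) x y f
  have h2 : d R L M 0 (ins 0 x f) ![y] = ⁅y, f ![x]⁆ := by
    rw [d_zero_apply]
    simp
  calc d R L M 1 f ![x, y] = ins 1 x (d R L M 1 f) ![y] := rfl
    _ = lieDer R L M 1 x f ![y] - d R L M 0 (ins 0 x f) ![y] := by rw [ins_d_succ]; rfl
    _ = _ := by rw [h1, h2]; abel

end Differential

/-! ### Functoriality in the coefficients -/

section Map

variable [LieRingModule L M] {M' : Type*} [AddCommGroup M'] [Module R M'] [LieRingModule L M']

variable (L) in
/-- A morphism of `L`-modules `φ : M → M'` acts on cochains by composition. [folklore] -/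
def map (φ : M →ₗ⁅R,L⁆ M') (q : ℕ) : Cochain R L M q →ₗ[R] Cochain R L M' q :=
  LinearMap.compAlternatingMapₗ R (φ : M →ₗ[R] M')

/-- `(φ_* f)(v) = φ (f v)`. [folklore] -/
@[simp] theorem map_apply (φ : M →ₗ⁅R,L⁆ M') (q : ℕ) (f : Cochain R L M q) (v : Fin q → L) :
    map L φ q f v = φ (f v) := rfl

/-- Insertion commutes with `φ_*`. [folklore] -/
theorem ins_map (φ : M →ₗ⁅R,L⁆ M') (q : ℕ) (x : L) (f : Cochain R L M (q + 1)) :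
    ins q x (map L φ (q + 1) f) = map L φ q (ins q x f) := rfl

variable [LieModule R L M] [LieModule R L M']

/-- The Lie derivative is natural in the coefficients. [folklore] -/
theorem lieDer_map (φ : M →ₗ⁅R,L⁆ M') (q : ℕ) (x : L) (f : Cochain R L M q) :
    lieDer R L M' q x (map L φ q f) = map L φ q (lieDer R L M q x f) := by
  induction q generalizing x with
  | zero => ext v; simp
  | succ q ih =>
    refine ext_ins fun y => ?_
    rw [ins_lieDer, ins_map, ih, ins_map, ins_map, ins_lieDer, map_sub]

/-- **The differential is natural in the coefficients**: `d ∘ φ_* = φ_* ∘ d`. [folklore] -/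
theorem d_map (φ : M →ₗ⁅R,L⁆ M') (q : ℕ) (f : Cochain R L M q) :
    d R L M' q (map L φ q f) = map L φ (q + 1) (d R L M q f) := by
  induction q with
  | zero =>
    refine ext_ins fun y => ?_
    rw [ins_d_zero, lieDer_map, ins_map, ins_d_zero]
  | succ q ih =>
    refine ext_ins fun y => ?_
    rw [ins_d_succ, lieDer_map, ins_map, ih, ins_map, ins_d_succ, map_sub]

end Map

/-! ### Subcomplexes, cocycles, coboundaries, cohomology -/

section Horizontal

/-- Horizontal cochains of a Lie subalgebra `K`: `i_x f = 0` for `x ∈ K` (no condition in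
degree `0`). [cite: ChevalleyEilenberg1948, §28 (28.1)] -/
def horizontal (K : LieSubalgebra R L) : (q : ℕ) → Submodule R (Cochain R L M q)
  | 0 => ⊤
  | q + 1 => ⨅ x : K, LinearMap.ker (ins (M := M) q (x : L))

/-- `f` is horizontal iff `i_x f = 0` for all `x ∈ K` ((28.1')).
[cite: ChevalleyEilenberg1948, §28 (28.1)] -/
theorem mem_horizontal_succ_iff (K : LieSubalgebra R L) (q : ℕ) (f : Cochain R L M (q + 1)) :
    f ∈ horizontal (M := M) K (q + 1) ↔ ∀ x ∈ K, ins q x f = 0 := by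
  simp only [horizontal, Submodule.mem_iInf, LinearMap.mem_ker, Subtype.forall]

end Horizontal

section Cohomology

variable [LieRingModule L M] [LieModule R L M]

/-- A `0`-cochain is a cocycle iff its value is `L`-invariant.
[cite: ChevalleyEilenberg1948, §23 (23.9)] -/
theorem d_zero_eq_zero_iff (f : Cochain R L M 0) :
    d R L M 0 f = 0 ↔ ∀ (x : L) (v : Fin 0 → L), ⁅x, f v⁆ = 0 := by
  constructor
  · intro h x v
    have e := congrArg (fun φ : Cochain R L M 0 => φ v) (ins_d_zero (R := R) (M := M) x f)
    simp only [h, map_zero, AlternatingMap.zero_apply, lieDer_zero_apply] at e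
    exact e.symm
  · intro h
    refine ext_ins fun x => ?_
    rw [ins_d_zero, map_zero]
    ext v
    simp [h x v]

variable (R L M) in
/-- A family of submodules of cochains stable under `d` (a subcomplex of the Chevalley–Eilenberg
complex), e.g. all cochains (`Subcomplex.top`) or the relative cochains of a Lie subalgebra
(`Subcomplex.rel`). [folklore] -/
structure Subcomplex where
  /-- the cochains of the subcomplex, degreewise -/
  carrier : (q : ℕ) → Submodule R (Cochain R L M q)
  /-- stability under the differential -/
  d_mem : ∀ (q : ℕ) (f : Cochain R L M q), f ∈ carrier q → d R L M q f ∈ carrier (q + 1)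

/-- Invariant cochains of a Lie subalgebra `K`: `θ_x f = 0` for `x ∈ K`.
[cite: ChevalleyEilenberg1948, §28 (28.2)] -/
def invariant (K : LieSubalgebra R L) (q : ℕ) : Submodule R (Cochain R L M q) :=
  ⨅ x : K, LinearMap.ker (lieDer R L M q (x : L))

/-- `f` is `K`-invariant iff `θ_x f = 0` for all `x ∈ K` ((28.2)).
[cite: ChevalleyEilenberg1948, §28 (28.2)] -/
theorem mem_invariant_iff (K : LieSubalgebra R L) (q : ℕ) (f : Cochain R L M q) :
    f ∈ invariant (M := M) K q ↔ ∀ x ∈ K, lieDer R L M q x f = 0 := by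
  simp only [invariant, Submodule.mem_iInf, LinearMap.mem_ker, Subtype.forall]

namespace Subcomplex

variable (S : Subcomplex R L M)

/-- The differential of a subcomplex. [folklore] -/
def dRes (q : ℕ) : S.carrier q →ₗ[R] S.carrier (q + 1) :=
  (d R L M q).restrict fun f hf => S.d_mem q f hf

/-- The restricted differential is `d` on underlying cochains. [folklore] -/
@[simp] theorem coe_dRes (q : ℕ) (f : S.carrier q) :
    (S.dRes q f : Cochain R L M (q + 1)) = d R L M q f :=
  rfl

/-- `d ∘ d = 0` on a subcomplex. [cite: ChevalleyEilenberg1948, §23 (23.2)] -/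
theorem dRes_dRes (q : ℕ) (f : S.carrier q) : S.dRes (q + 1) (S.dRes q f) = 0 :=
  Subtype.ext (d_d q (f : Cochain R L M q))

/-- Cocycles `Z^q = S_q ∩ ker d`. [cite: ChevalleyEilenberg1948, §28] -/
def cocycles (q : ℕ) : Submodule R (Cochain R L M q) := S.carrier q ⊓ LinearMap.ker (d R L M q)

/-- Coboundaries `B^q = d(S_{q-1})` (`B⁰ = 0`). [cite: ChevalleyEilenberg1948, §28] -/
def coboundaries : (q : ℕ) → Submodule R (Cochain R L M q)
  | 0 => ⊥
  | q + 1 => (S.carrier q).map (d R L M q)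

/-- `f ∈ Z^q` iff `f ∈ S_q` and `d f = 0`. [cite: ChevalleyEilenberg1948, §28] -/
theorem mem_cocycles_iff (q : ℕ) (f : Cochain R L M q) :
    f ∈ S.cocycles q ↔ f ∈ S.carrier q ∧ d R L M q f = 0 := by
  simp only [cocycles, Submodule.mem_inf, LinearMap.mem_ker]

/-- `f ∈ B^{q+1}` iff `f = d g` for some `g ∈ S_q`. [cite: ChevalleyEilenberg1948, §28] -/
theorem mem_coboundaries_succ_iff (q : ℕ) (f : Cochain R L M (q + 1)) :
    f ∈ S.coboundaries (q + 1) ↔ ∃ g ∈ S.carrier q, d R L M q g = f :=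
  Submodule.mem_map

/-- `B^q ≤ Z^q` (from `d ∘ d = 0` and `d`-stability). [cite: ChevalleyEilenberg1948, §28] -/
theorem coboundaries_le_cocycles (q : ℕ) : S.coboundaries q ≤ S.cocycles q := by
  cases q with
  | zero => exact bot_le
  | succ q =>
    rintro _ ⟨g, hg, rfl⟩
    exact (S.mem_cocycles_iff (q + 1) _).2 ⟨S.d_mem q g hg, d_d q g⟩

/-- **The cohomology `H^q = Z^q / B^q` of the subcomplex.** [cite: ChevalleyEilenberg1948, §28] -/
def Cohomology (q : ℕ) : Type _ :=
  S.cocycles q ⧸ ((S.coboundaries q).comap (S.cocycles q).subtype)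

/-- `H^q` is an abelian group (quotient structure). [folklore] -/
instance (q : ℕ) : AddCommGroup (S.Cohomology q) :=
  inferInstanceAs (AddCommGroup (S.cocycles q ⧸ ((S.coboundaries q).comap (S.cocycles q).subtype)))

/-- `H^q` is an `R`-module (quotient structure). [folklore] -/
instance (q : ℕ) : Module R (S.Cohomology q) :=
  inferInstanceAs (Module R (S.cocycles q ⧸ ((S.coboundaries q).comap (S.cocycles q).subtype)))

/-- The class of a cocycle. [folklore] -/
def toCohomology (q : ℕ) : S.cocycles q →ₗ[R] S.Cohomology q :=
  ((S.coboundaries q).comap (S.cocycles q).subtype).mkQ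

/-- Every class is the class of a cocycle. [folklore] -/
theorem toCohomology_surjective (q : ℕ) : Function.Surjective (S.toCohomology q) :=
  Submodule.mkQ_surjective _

/-- A cocycle has zero class iff it is a coboundary. [folklore] -/
theorem toCohomology_eq_zero_iff (q : ℕ) (z : S.cocycles q) :
    S.toCohomology q z = 0 ↔ (z : Cochain R L M q) ∈ S.coboundaries q := by
  change ((S.coboundaries q).comap (S.cocycles q).subtype).mkQ z = 0 ↔ _
  rw [Submodule.mkQ_apply, Submodule.Quotient.mk_eq_zero, Submodule.mem_comap,
Submodule.subtype_apply]

/-- The subcomplex as a cochain complex of `R`-modules (Mathlib `CochainComplex`), for use with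
the homological-algebra API. [folklore] -/
def toComplex : CochainComplex (ModuleCat R) ℕ :=
  CochainComplex.of (fun q => ModuleCat.of R (S.carrier q)) (fun q => ModuleCat.ofHom (S.dRes q))
    fun q => by
      ext f
      simp [S.dRes_dRes q f]

variable (R L M) in
/-- The full Chevalley–Eilenberg complex. [cite: ChevalleyEilenberg1948, §23] -/
def top : Subcomplex R L M where
  carrier _ := ⊤
  d_mem _ _ _ := trivial

variable (R L M) in
/-- **The relative Chevalley–Eilenberg complex `C^•(L, K; M) = Hom_K(Λ^•(L/K), M)`** of a Lie
subalgebra `K ≤ L`: cochains that are horizontal (`i_x f = 0`) and invariant (`θ_x f = 0`) for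
all `x ∈ K`; stable under `d` by Cartan's formula and `θ_x d = d θ_x`.
[cite: ChevalleyEilenberg1948, §28 (28.1)–(28.2)] -/
def rel (K : LieSubalgebra R L) : Subcomplex R L M where
  carrier q := invariant K q ⊓ horizontal K q
  d_mem q f hf := by
    obtain ⟨hi, hh⟩ := Submodule.mem_inf.1 hf
    rw [mem_invariant_iff] at hi
    refine Submodule.mem_inf.2 ⟨?_, ?_⟩
    · rw [mem_invariant_iff]
      intro x hx
      rw [lieDer_d, hi x hx, map_zero]
    · rw [mem_horizontal_succ_iff]
      intro x hx
      cases q with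
      | zero => rw [ins_d_zero, hi x hx]
      | succ q =>
        rw [mem_horizontal_succ_iff] at hh
        rw [ins_d_succ, hi x hx, hh x hx, map_zero, sub_zero]

/-- Relative `0`-cochains: `θ_x f = 0` for `x ∈ K` (no horizontality condition).
[cite: ChevalleyEilenberg1948, §28 (28.2)] -/
theorem mem_rel_zero_iff (K : LieSubalgebra R L) (f : Cochain R L M 0) :
    f ∈ (rel R L M K).carrier 0 ↔ ∀ x ∈ K, lieDer R L M 0 x f = 0 := by
  change f ∈ invariant K 0 ⊓ horizontal K 0 ↔ _
  rw [Submodule.mem_inf, mem_invariant_iff]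
  exact ⟨fun h => h.1, fun h => ⟨h, trivial⟩⟩

/-- Relative cochains of positive degree: `θ_x f = 0` and `i_x f = 0` for `x ∈ K`.
[cite: ChevalleyEilenberg1948, §28 (28.1)–(28.2)] -/
theorem mem_rel_succ_iff (K : LieSubalgebra R L) (q : ℕ) (f : Cochain R L M (q + 1)) :
    f ∈ (rel R L M K).carrier (q + 1) ↔
      ∀ x ∈ K, lieDer R L M (q + 1) x f = 0 ∧ ins q x f = 0 := by
  change f ∈ invariant K (q + 1) ⊓ horizontal K (q + 1) ↔ _
  rw [Submodule.mem_inf, mem_invariant_iff, mem_horizontal_succ_iff]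
  exact ⟨fun h x hx => ⟨h.1 x hx, h.2 x hx⟩, fun h => ⟨fun x hx => (h x hx).1, fun x hx => (h x
hx).2⟩⟩

end Subcomplex

variable (R L M) in
/-- **Lie algebra cohomology `H^q(L; M)`** (Chevalley–Eilenberg).
[cite: ChevalleyEilenberg1948, §23] -/
abbrev cohomology (q : ℕ) : Type _ := (Subcomplex.top R L M).Cohomology q

variable (R L M) in
/-- **Relative Lie algebra cohomology `H^q(L, K; M)`** of a Lie subalgebra `K ≤ L`.
[cite: BorelWallach2000, I §1.2 (1)] -/
abbrev relCohomology (K : LieSubalgebra R L) (q : ℕ) : Type _ := (Subcomplex.rel R L M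
K).Cohomology q

/-- **`H⁰(L, K; M) = M^L`**: a `0`-cochain (a vector of `M`) is a relative cocycle iff it is
`L`-invariant; there are no coboundaries in degree `0`. [cite: BorelWallach2000, I §1.2 (3)] -/
theorem mem_cocycles_zero_iff (S : Subcomplex R L M) (f : Cochain R L M 0) :
    f ∈ S.cocycles 0 ↔ f ∈ S.carrier 0 ∧ ∀ (x : L) (v : Fin 0 → L), ⁅x, f v⁆ = 0 := by
  rw [S.mem_cocycles_iff, d_zero_eq_zero_iff]

end Cohomology

end ChevalleyEilenberg

end Literature.Algebra.Lie
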